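import Summits.Ventures.PercRepro.SixThreeShares

/-!
# PercRepro — generic pairs over a plane: at least `2n − 3` of the `C(n, 2)` pairs of `n` outside points (p2, gen 6)

mine-2 `MINE2-RLS.md` §19.6: the contraction `N = M/G` on a set `W` of `n` points outside the plane `G` with
`ρ(G ∪ W) ≥ 6` has rank `≥ 3`, so it has at most `π = C(n − 2, 2)` parallel pairs (`π = 3, 1, 0` for `n = 5, 4, 3`).
Here this is stated without contractions: a pair `{x, x′} ⊆ W` is GENERIC when `ρ(G ∪ {x, x′}) = 5` (its witness
`B ∪ {x, x′}` has rank `5` for every rank-`3` subset `B` of `G`), PARALLEL when `ρ(G ∪ {x, x′}) = 4`.  Parallelism is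
transitive (`parallel_trans`: the rank-`4` flats `cl(G ∪ {x})` coincide), and three points `x₁, x₂, x₃ ∈ W` with
`ρ(G ∪ {x₁, x₂, x₃}) = 6` are pairwise generic while every other `y ∈ W` is parallel to at most one of them.  Hence
`card_generic_ge`: at least `3 + 2(n − 3) = 2n − 3` generic pairs.
-/

namespace PercRepro

namespace SixThree

open Finset ThmH

variable {α : Type*} [DecidableEq α] {M : Matroid α} [M.Finite]

/-- `ρ(G ∪ {x, x′}) ≤ 5` for a plane `G`. -/
theorem eRk_plane_pair_le {G : Finset α} (hG : G ∈ planes M) (x x' : α) :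
    M.eRk ((G ∪ {x, x'} : Finset α) : Set α) ≤ 5 := by
  have h := eRk_pair_insert_le (M := M) G x x'
  rw [(mem_planes.1 hG).2.2] at h
  have heq : G ∪ {x, x'} = insert x (insert x' G) := by
    ext y; simp only [Finset.mem_union, Finset.mem_insert, Finset.mem_singleton]; tauto
  rw [heq]
  exact h.trans (by norm_num)

/-- `ρ(G ∪ {x, x′}) ≥ 4` for a plane `G` and `x ∉ G` in the ground set. -/
theorem four_le_eRk_plane_pair {G : Finset α} (hG : G ∈ planes M) {x : α} (hx : x ∈ gr M) (hxG : x ∉ G)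
    (x' : α) : (4 : ℕ∞) ≤ M.eRk ((G ∪ {x, x'} : Finset α) : Set α) := by
  have h4 := eRk_insert_eq_four hG (Finset.Subset.refl G) (mem_planes.1 hG).2.2 hx hxG
  rw [← h4]
  apply M.eRk_mono (Finset.coe_subset.2 _)
  intro y hy
  rw [Finset.mem_insert] at hy
  rw [Finset.mem_union, Finset.mem_insert, Finset.mem_singleton]
  rcases hy with rfl | hyG
  · exact Or.inr (Or.inl rfl)
  · exact Or.inl hyG

/-- A point `y ∉ G` with `ρ(G ∪ {x, y}) ≤ 4` lies in `cl(G ∪ {x})`. -/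
theorem mem_closure_of_parallel {G : Finset α} (hG : G ∈ planes M) {x y : α} (hx : x ∈ gr M) (hxG : x ∉ G)
    (hy : y ∈ gr M) (hpar : M.eRk ((G ∪ {x, y} : Finset α) : Set α) ≤ 4) :
    y ∈ M.closure ((insert x G : Finset α) : Set α) := by
  by_contra hnot
  have hyE : y ∈ M.E := by rw [← coe_gr M]; exact_mod_cast hy
  have h4 := eRk_insert_eq_four hG (Finset.Subset.refl G) (mem_planes.1 hG).2.2 hx hxG
  have := M.eRk_insert_eq_add_one (e := y) (X := ((insert x G : Finset α) : Set α)) ⟨hyE, hnot⟩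
  rw [h4] at this
  have heq : ((G ∪ {x, y} : Finset α) : Set α) = insert y ((insert x G : Finset α) : Set α) := by
    push_cast
    ext z; simp only [Set.mem_union, Set.mem_insert_iff, Set.mem_singleton_iff]; tauto
  rw [heq, this] at hpar
  exact absurd hpar (by decide)

/-- Parallelism over `G` is transitive: `ρ(G ∪ {x, y}) ≤ 4` and `ρ(G ∪ {y, z}) ≤ 4` give `ρ(G ∪ {x, z}) ≤ 4`
(the flats `cl(G ∪ {x})`, `cl(G ∪ {y})` coincide). -/
theorem parallel_trans {G : Finset α} (hG : G ∈ planes M) {x y z : α} (hx : x ∈ gr M) (hxG : x ∉ G)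
    (hy : y ∈ gr M) (hyG : y ∉ G) (hz : z ∈ gr M)
    (hxy : M.eRk ((G ∪ {x, y} : Finset α) : Set α) ≤ 4) (hyz : M.eRk ((G ∪ {y, z} : Finset α) : Set α) ≤ 4) :
    M.eRk ((G ∪ {x, z} : Finset α) : Set α) ≤ 4 := by
  have hy' := mem_closure_of_parallel hG hx hxG hy hxy
  have hz' := mem_closure_of_parallel hG hy hyG hz hyz
  -- `cl(G ∪ {y}) ⊆ cl(G ∪ {x})`
  have hsub : M.closure ((insert y G : Finset α) : Set α) ⊆ M.closure ((insert x G : Finset α) : Set α) := by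
    rw [← M.closure_closure ((insert x G : Finset α) : Set α)]
    apply M.closure_subset_closure
    rw [Finset.coe_insert]
    apply Set.insert_subset hy'
    exact (Finset.coe_subset.2 (Finset.subset_insert _ _)).trans (M.subset_closure _ (by
      rw [← coe_gr M]
      exact_mod_cast Finset.insert_subset hx (mem_planes.1 hG).1))
  have hzx : z ∈ M.closure ((insert x G : Finset α) : Set α) := hsub hz'
  -- so `ρ(G ∪ {x, z}) = ρ(G ∪ {x}) = 4`
  have h4 := eRk_insert_eq_four hG (Finset.Subset.refl G) (mem_planes.1 hG).2.2 hx hxG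
  have heq : ((G ∪ {x, z} : Finset α) : Set α) = insert z ((insert x G : Finset α) : Set α) := by
    push_cast
    ext w; simp only [Set.mem_union, Set.mem_insert_iff, Set.mem_singleton_iff]; tauto
  rw [heq]
  have hsub' : insert z ((insert x G : Finset α) : Set α) ⊆ M.closure ((insert x G : Finset α) : Set α) :=
    Set.insert_subset hzx (M.subset_closure _ (by
      rw [← coe_gr M]
      exact_mod_cast Finset.insert_subset hx (mem_planes.1 hG).1))
  calc M.eRk (insert z ((insert x G : Finset α) : Set α))
      ≤ M.eRk (M.closure ((insert x G : Finset α) : Set α)) := M.eRk_mono hsub'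
    _ = 4 := by rw [M.eRk_closure_eq, h4]

/-- The generic pairs of `W` over the plane `G`: `{x, x′} ⊆ W` with `ρ(G ∪ {x, x′}) = 5`. -/
noncomputable def genericPairs (M : Matroid α) [M.Finite] (G W : Finset α) : Finset (Finset α) :=
  (W.powersetCard 2).filter (fun X : Finset α => M.eRk ((G ∪ X : Finset α) : Set α) = 5)

/-- Three points of `W` independent over `G`: `ρ(G ∪ {x₁, x₂, x₃}) = 6` when `ρ(G ∪ W) ≥ 6`. -/
theorem exists_three_independent {G W : Finset α} (hG : G ∈ planes M)
    (hr : (6 : ℕ∞) ≤ M.eRk ((G ∪ W : Finset α) : Set α)) :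
    ∃ x₁ ∈ W, ∃ x₂ ∈ W, ∃ x₃ ∈ W, x₁ ∉ G ∧ x₂ ∉ G ∧ x₃ ∉ G ∧
      M.eRk ((G ∪ {x₁, x₂} : Finset α) : Set α) = 5 ∧ M.eRk ((G ∪ {x₁, x₃} : Finset α) : Set α) = 5 ∧
      M.eRk ((G ∪ {x₂, x₃} : Finset α) : Set α) = 5 := by
  have hG3 := (mem_planes.1 hG).2.2
  -- first point
  have h1 : M.eRk (G : Set α) < M.eRk ((G ∪ W : Finset α) : Set α) := by
    rw [hG3]; exact lt_of_lt_of_le (by decide) hr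
  obtain ⟨x₁, hx₁, hr1⟩ := Matroid.exists_eRk_insert_eq_add_one_of_lt h1
  rw [Finset.coe_union, Set.mem_sdiff, Set.mem_union] at hx₁
  have hx₁W : x₁ ∈ W := by
    rcases hx₁.1 with h | h
    · exact absurd h hx₁.2
    · exact_mod_cast h
  have hx₁G : x₁ ∉ G := fun h => hx₁.2 (by exact_mod_cast h)
  rw [hG3] at hr1
  -- second point
  have h2 : M.eRk (insert x₁ (G : Set α)) < M.eRk ((G ∪ W : Finset α) : Set α) := by
    rw [hr1]; exact lt_of_lt_of_le (by decide) hr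
  obtain ⟨x₂, hx₂, hr2⟩ := Matroid.exists_eRk_insert_eq_add_one_of_lt h2
  rw [Finset.coe_union, Set.mem_sdiff, Set.mem_union, Set.mem_insert_iff] at hx₂
  have hx₂W : x₂ ∈ W := by
    rcases hx₂.1 with h | h
    · exact absurd (Or.inr h) hx₂.2
    · exact_mod_cast h
  have hx₂G : x₂ ∉ G := fun h => hx₂.2 (Or.inr (by exact_mod_cast h))
  rw [hr1] at hr2
  -- third point
  have h3 : M.eRk (insert x₂ (insert x₁ (G : Set α))) < M.eRk ((G ∪ W : Finset α) : Set α) := by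
    rw [hr2]; exact lt_of_lt_of_le (by decide) hr
  obtain ⟨x₃, hx₃, hr3⟩ := Matroid.exists_eRk_insert_eq_add_one_of_lt h3
  rw [Finset.coe_union, Set.mem_sdiff, Set.mem_union, Set.mem_insert_iff, Set.mem_insert_iff] at hx₃
  have hx₃W : x₃ ∈ W := by
    rcases hx₃.1 with h | h
    · exact absurd (Or.inr (Or.inr h)) hx₃.2
    · exact_mod_cast h
  have hx₃G : x₃ ∉ G := fun h => hx₃.2 (Or.inr (Or.inr (by exact_mod_cast h)))
  rw [hr2] at hr3
  refine ⟨x₁, hx₁W, x₂, hx₂W, x₃, hx₃W, hx₁G, hx₂G, hx₃G, ?_, ?_, ?_⟩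
  · have heq : ((G ∪ {x₁, x₂} : Finset α) : Set α) = insert x₂ (insert x₁ (G : Set α)) := by
      push_cast; ext w; simp only [Set.mem_union, Set.mem_insert_iff, Set.mem_singleton_iff]; tauto
    rw [heq, hr2]; rfl
  · apply le_antisymm (eRk_plane_pair_le hG x₁ x₃)
    -- `6 = ρ(G ∪ {x₁, x₂, x₃}) ≤ ρ(G ∪ {x₁, x₃}) + 1`
    have hsub : insert x₃ (insert x₂ (insert x₁ (G : Set α))) ⊆
        insert x₂ ((G ∪ {x₁, x₃} : Finset α) : Set α) := by
      push_cast; intro w hw; simp only [Set.mem_insert_iff, Set.mem_union, Set.mem_singleton_iff] at hw ⊢; tauto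
    have h := (M.eRk_mono hsub).trans (M.eRk_insert_le_add_one x₂ _)
    rw [hr3] at h
    obtain ⟨k, hk, -⟩ := eRk_eq_nat M (G ∪ {x₁, x₃})
    rw [hk] at h ⊢
    have : ((6 : ℕ) : ℕ∞) ≤ ((k + 1 : ℕ) : ℕ∞) := by push_cast; exact h
    have := (Nat.cast_le (α := ℕ∞)).1 this
    exact_mod_cast (show 5 ≤ k by omega)
  · apply le_antisymm (eRk_plane_pair_le hG x₂ x₃)
    have hsub : insert x₃ (insert x₂ (insert x₁ (G : Set α))) ⊆
        insert x₁ ((G ∪ {x₂, x₃} : Finset α) : Set α) := by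
      push_cast; intro w hw; simp only [Set.mem_insert_iff, Set.mem_union, Set.mem_singleton_iff] at hw ⊢; tauto
    have h := (M.eRk_mono hsub).trans (M.eRk_insert_le_add_one x₁ _)
    rw [hr3] at h
    obtain ⟨k, hk, -⟩ := eRk_eq_nat M (G ∪ {x₂, x₃})
    rw [hk] at h ⊢
    have : ((6 : ℕ) : ℕ∞) ≤ ((k + 1 : ℕ) : ℕ∞) := by push_cast; exact h
    have := (Nat.cast_le (α := ℕ∞)).1 this
    exact_mod_cast (show 5 ≤ k by omega)

/-- **At least `2n − 3` generic pairs** among `n ≥ 3` points `W` outside the plane `G` with `ρ(G ∪ W) ≥ 6`: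
three points independent over `G` are pairwise generic, and every other point is parallel to at most one of them. -/
theorem card_generic_ge {G W : Finset α} (hG : G ∈ planes M) (hW : W ⊆ gr M) (hWG : Disjoint W G)
    (hr : (6 : ℕ∞) ≤ M.eRk ((G ∪ W : Finset α) : Set α)) :
    2 * W.card ≤ (genericPairs M G W).card + 3 := by
  classical
  obtain ⟨x₁, hx₁, x₂, hx₂, x₃, hx₃, hx₁G, hx₂G, hx₃G, h12, h13, h23⟩ := exists_three_independent hG hr
  have hWG' : ∀ y ∈ W, y ∉ G := fun y hy => Finset.disjoint_left.1 hWG hy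
  have h12' : x₁ ≠ x₂ := by
    rintro rfl
    have := eRk_insert_eq_four hG (Finset.Subset.refl G) (mem_planes.1 hG).2.2 (hW hx₁) hx₁G
    have heq : (G ∪ {x₁, x₁} : Finset α) = insert x₁ G := by
      ext w; simp only [Finset.mem_union, Finset.mem_insert, Finset.mem_singleton]; tauto
    rw [heq, this] at h12
    exact absurd h12 (by decide)
  have h13' : x₁ ≠ x₃ := by
    rintro rfl
    have := eRk_insert_eq_four hG (Finset.Subset.refl G) (mem_planes.1 hG).2.2 (hW hx₁) hx₁G
    have heq : (G ∪ {x₁, x₁} : Finset α) = insert x₁ G := by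
      ext w; simp only [Finset.mem_union, Finset.mem_insert, Finset.mem_singleton]; tauto
    rw [heq, this] at h13
    exact absurd h13 (by decide)
  have h23' : x₂ ≠ x₃ := by
    rintro rfl
    have := eRk_insert_eq_four hG (Finset.Subset.refl G) (mem_planes.1 hG).2.2 (hW hx₂) hx₂G
    have heq : (G ∪ {x₂, x₂} : Finset α) = insert x₂ G := by
      ext w; simp only [Finset.mem_union, Finset.mem_insert, Finset.mem_singleton]; tauto
    rw [heq, this] at h23
    exact absurd h23 (by decide)
  set T₀ : Finset α := {x₁, x₂, x₃} with hT₀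
  have hT₀W : T₀ ⊆ W := by
    intro y hy; rw [hT₀] at hy; simp only [Finset.mem_insert, Finset.mem_singleton] at hy
    rcases hy with rfl | rfl | rfl <;> assumption
  have hT₀card : T₀.card = 3 := by
    rw [hT₀, Finset.card_insert_of_notMem (by simp [h12', h13']), Finset.card_pair h23']
  -- symmetric form of the pair rank
  have hsymm : ∀ a b : α, (G ∪ {a, b} : Finset α) = G ∪ {b, a} := by
    intro a b; ext w; simp only [Finset.mem_union, Finset.mem_insert, Finset.mem_singleton]; tauto
  -- the pairs inside `T₀` are generic
  have hA : T₀.powersetCard 2 ⊆ genericPairs M G W := by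
    intro X hX
    rw [Finset.mem_powersetCard] at hX
    unfold genericPairs
    rw [Finset.mem_filter, Finset.mem_powersetCard]
    refine ⟨⟨hX.1.trans hT₀W, hX.2⟩, ?_⟩
    obtain ⟨a, b, hab, rfl⟩ := Finset.card_eq_two.1 hX.2
    have ha : a ∈ T₀ := hX.1 (by simp)
    have hb : b ∈ T₀ := hX.1 (by simp)
    rw [hT₀] at ha hb
    simp only [Finset.mem_insert, Finset.mem_singleton] at ha hb
    rcases ha with rfl | rfl | rfl <;> rcases hb with rfl | rfl | rfl <;>
      first | exact absurd rfl hab | assumption | (rw [hsymm]; assumption)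
  -- every other point gives at least two generic pairs with `T₀`
  set R := W \ T₀ with hR
  have hRcard : R.card = W.card - 3 := by
    rw [hR, Finset.card_sdiff_of_subset hT₀W, hT₀card]
  have hB : ∀ y ∈ R, 2 ≤ ((T₀.filter (fun x => M.eRk ((G ∪ {y, x} : Finset α) : Set α) = 5)).image
      (fun x => ({y, x} : Finset α))).card := by
    intro y hy
    rw [hR, Finset.mem_sdiff] at hy
    have hyG : y ∉ G := hWG' y hy.1
    -- at most one point of `T₀` is parallel to `y`
    have hbad : (T₀.filter (fun x => ¬ M.eRk ((G ∪ {y, x} : Finset α) : Set α) = 5)).card ≤ 1 := by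
      rw [Finset.card_le_one]
      intro a ha b hb
      rw [Finset.mem_filter] at ha hb
      by_contra hab
      have hpar : ∀ c ∈ T₀, ¬ M.eRk ((G ∪ {y, c} : Finset α) : Set α) = 5 →
          M.eRk ((G ∪ {y, c} : Finset α) : Set α) ≤ 4 := by
        intro c hc hne
        have hle := eRk_plane_pair_le hG y c
        obtain ⟨k, hk, -⟩ := eRk_eq_nat M (G ∪ {y, c})
        rw [hk] at hle hne ⊢
        have hk5 : k ≤ 5 := by exact_mod_cast hle
        have hk5' : k ≠ 5 := fun h => hne (by rw [h]; rfl)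
        exact_mod_cast (show k ≤ 4 by omega)
      have hay := hpar a ha.1 ha.2
      have hby := hpar b hb.1 hb.2
      rw [hsymm] at hay
      have hab4 := parallel_trans hG (hW (hT₀W ha.1)) (hWG' a (hT₀W ha.1)) (hW hy.1) hyG (hW (hT₀W hb.1)) hay hby
      -- but the pairs of `T₀` are generic
      have hgen : M.eRk ((G ∪ {a, b} : Finset α) : Set α) = 5 := by
        have : ({a, b} : Finset α) ∈ T₀.powersetCard 2 := by
          rw [Finset.mem_powersetCard]
          refine ⟨?_, Finset.card_pair hab⟩
          intro w hw; simp only [Finset.mem_insert, Finset.mem_singleton] at hw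
          rcases hw with rfl | rfl; exact ha.1; exact hb.1
        have := hA this
        unfold genericPairs at this
        exact (Finset.mem_filter.1 this).2
      rw [hgen] at hab4
      exact absurd hab4 (by decide)
    have hgood : 2 ≤ (T₀.filter (fun x => M.eRk ((G ∪ {y, x} : Finset α) : Set α) = 5)).card := by
      have := Finset.card_filter_add_card_filter_not (s := T₀)
        (p := fun x => M.eRk ((G ∪ {y, x} : Finset α) : Set α) = 5)
      omega
    rw [Finset.card_image_of_injOn]
    · exact hgood
    · intro a ha b hb hab
      simp only at hab
      have ha' : a ∈ T₀ := (Finset.mem_filter.1 ha).1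
      have hb' : b ∈ T₀ := (Finset.mem_filter.1 hb).1
      have hay : a ≠ y := fun h => hy.2 (h ▸ ha')
      have : a ∈ ({y, b} : Finset α) := by rw [← hab]; simp
      simp only [Finset.mem_insert, Finset.mem_singleton] at this
      rcases this with h | h
      · exact absurd h hay
      · exact h
  -- assemble: the families are disjoint and lie in the generic pairs
  set Bfam := R.biUnion (fun y => (T₀.filter (fun x => M.eRk ((G ∪ {y, x} : Finset α) : Set α) = 5)).image
      (fun x => ({y, x} : Finset α))) with hBfam
  have hBsub : Bfam ⊆ genericPairs M G W := by
    intro X hX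
    rw [hBfam, Finset.mem_biUnion] at hX
    obtain ⟨y, hy, hX⟩ := hX
    rw [Finset.mem_image] at hX
    obtain ⟨x, hx, rfl⟩ := hX
    rw [Finset.mem_filter] at hx
    rw [hR, Finset.mem_sdiff] at hy
    have hyx : y ≠ x := fun h => hy.2 (h ▸ hx.1)
    unfold genericPairs
    rw [Finset.mem_filter, Finset.mem_powersetCard]
    refine ⟨⟨?_, Finset.card_pair hyx⟩, hx.2⟩
    intro w hw; simp only [Finset.mem_insert, Finset.mem_singleton] at hw
    rcases hw with rfl | rfl; exact hy.1; exact hT₀W hx.1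
  have hdisjAB : Disjoint (T₀.powersetCard 2) Bfam := by
    rw [Finset.disjoint_left]
    intro X hXA hXB
    rw [Finset.mem_powersetCard] at hXA
    rw [hBfam, Finset.mem_biUnion] at hXB
    obtain ⟨y, hy, hXB⟩ := hXB
    rw [Finset.mem_image] at hXB
    obtain ⟨x, -, rfl⟩ := hXB
    rw [hR, Finset.mem_sdiff] at hy
    exact hy.2 (hXA.1 (by simp))
  have hBcard : 2 * R.card ≤ Bfam.card := by
    rw [hBfam, Finset.card_biUnion]
    · calc 2 * R.card = ∑ _y ∈ R, 2 := by rw [Finset.sum_const, smul_eq_mul, mul_comm]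
        _ ≤ _ := Finset.sum_le_sum hB
    · intro y hy y' hy' hyy'
      simp only [Function.onFun]
      rw [Finset.disjoint_left]
      intro X hX hX'
      rw [Finset.mem_image] at hX hX'
      obtain ⟨x, hx, rfl⟩ := hX
      obtain ⟨x', -, hX'⟩ := hX'
      have hy'mem : y' ∈ ({y, x} : Finset α) := by rw [← hX']; simp
      simp only [Finset.mem_insert, Finset.mem_singleton] at hy'mem
      rcases hy'mem with h | h
      · exact hyy' h.symm
      · have hy'R : y' ∈ W \ T₀ := Finset.mem_coe.1 hy'
        exact (Finset.mem_sdiff.1 hy'R).2 (h ▸ (Finset.mem_filter.1 hx).1)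
  have hunion : (T₀.powersetCard 2 ∪ Bfam).card ≤ (genericPairs M G W).card :=
    Finset.card_le_card (Finset.union_subset hA hBsub)
  rw [Finset.card_union_of_disjoint hdisjAB, Finset.card_powersetCard, hT₀card] at hunion
  have h3 : Nat.choose 3 2 = 3 := by decide
  rw [h3] at hunion
  omega

end SixThree

end PercRepro
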